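import Literature.Computability.AlgebraicComplexity.ValiantBooleanBridgeAvM
import Literature.Computability.AlgebraicComplexity.PRelPermanentNSUBEXP
import Literature.Computability.AlgebraicComplexity.PermanentGraphNSUBEXPProofs
import Literature.Computability.QuantumComplexity.PermanentHardnessProofs
import HarnessLib

/-!
# Kabanets–Impagliazzo (pnp.S39): discharge of the named fact `kabanets_impagliazzo`

Discharge file of `Literature.Computability.AlgebraicComplexity.ValiantBooleanBridge` for the
named fact **pnp.S39** `kabanets_impagliazzo` (Kabanets–Impagliazzo, STOC 2003, Def. 1 + Thm. 18,
p. 359; Comput. Complexity 13 (2004) 1–46, Thm. 1.1): if polynomial identity testing for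
division-free arithmetic circuits over `ℤ` is in `⋂_{ε>0} NTIME(2^{n^ε})`, then `NEXP ⊄ P/poly` or
the permanent family `(PER_n)` has no p-bounded constant-free arithmetic circuits over `ℤ`.

The proof is the Aaronson–van Melkebeek line (*On circuit lower bounds from derandomization*,
Theory of Computing 7 (2011), §3.3): assuming all three of `PIT ∈ NSUBEXP`, `NEXP ⊆ P/poly` and
small circuits for the permanent, `Σ₂ᵖ ⊆ NSUBEXP ⊆ NTIME(2ⁿ) ⊆ NE ⊆ ⋃_c SIZE(c·nᵏ + c)` for one
exponent `k`, against Kannan's theorem. Its assembly from three named facts is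
`kabanets_impagliazzo_of_facts₃` (`ValiantBooleanBridgeAvM.lean`); the three facts are now
theorems of the tree:

| fact | discharged by |
|---|---|
| Valiant 1979, Thm. 1: the `0/1` permanent is `#P`-hard (`permanent01_isSharpPHardFun`) | `permanent01_isSharpPHardFun_holds` (`QuantumComplexity/PermanentHardnessProofs.lean`) |
| KI 2003, Cor. 12: `PIT ∈ NSUBEXP` and small circuits put the permanent graph in `NSUBEXP` (`permanent01Graph_mem_NSUBEXP_of_PIT`) | `permanent01Graph_mem_NSUBEXP_of_PIT_holds` (`PermanentGraphNSUBEXPProofs.lean`) |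
| KI 2003, Lemma 3: `graph(per) ∈ NSUBEXP ⟹ P^{per} ⊆ NSUBEXP` (`PRel_per01_subset_NSUBEXP_of_graph`) | `PRel_per01_subset_NSUBEXP_of_graph_holds` (`PRelPermanentNSUBEXP.lean`) |

together with the earlier discharges used inside the assembly (`kannan_holds`,
`NE_subset_SIZE_of_NEXP_subset_PPoly_holds`, `polyExists_NSUBEXP_subset_NSUBEXP_holds`,
`NSUBEXP_of_karpReducible_holds`, `NP_subset_PP_holds`, `PP_subset_PSharpP_holds`). Hence
`kabanets_impagliazzo_holds`, unconditionally; this file only plugs the discharges in (no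
statement is introduced or changed).

## References

* V. Kabanets, R. Impagliazzo, *Derandomizing polynomial identity tests means proving circuit
  lower bounds*, STOC 2003, 355–364: Thm. 1, Lemma 3 (p. 357), Lemma 11 and Cor. 12 (p. 358),
  Def. 1 and Thm. 18 (p. 359); journal version Comput. Complexity 13 (2004) 1–46, Thm. 1.1.
* S. Aaronson, D. van Melkebeek, *On circuit lower bounds from derandomization*, Theory of
  Computing 7 (2011) 177–184, §3.1 (Lemma 3.1), §3.3.
* L. G. Valiant, *The complexity of computing the permanent*, Theoret. Comput. Sci. 8 (1979)
  189–201, Thm. 1.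
* R. Kannan, *Circuit-size lower bounds and non-reducibility to sparse sets*, Inform. Control 55
  (1982) 40–56, Thm. 2.
-/

noncomputable section

namespace Literature.Computability.AlgebraicComplexity

open _root_.Computability Complexity QuantumComplexity Nondeterministic

/-- **The three hypotheses of pnp.S39 are contradictory (unconditional form).** `PIT ∈ NSUBEXP`,
`NEXP ⊆ P/poly` and p-bounded constant-free circuits for `(PER_n)` cannot hold together
(Aaronson–van Melkebeek 2011, §3.3: "All together (3) yields a contradiction to the result of
Kannan's"; Kabanets–Impagliazzo 2003, proof of Thm. 18, p. 359): `false_of_PIT_NEXP_per_avm` with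
every fact discharged. [cite: AaronsonMelkebeek2011, §3.3] [cite: KabanetsImpagliazzo2003, Thm. 18 (p. 359)] -/
theorem false_of_PIT_NEXP_per_holds (hPIT : PITLanguage ∈ NSUBEXP) (hNEXP : NEXP ⊆ PPoly)
    (hper : IsPBounded (fun n => constantFreeComplexity (perPoly (Fin n) ℤ))) : False :=
  false_of_PIT_NEXP_per_avm permanent01_isSharpPHardFun_holds
    permanent01Graph_mem_NSUBEXP_of_PIT_holds PRel_per01_subset_NSUBEXP_of_graph_holds
    NE_subset_SIZE_of_NEXP_subset_PPoly_holds polyExists_NSUBEXP_subset_NSUBEXP_holds hPIT hNEXP hper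

/-- **pnp.S39, the Kabanets–Impagliazzo theorem, DISCHARGED** (Kabanets–Impagliazzo, STOC 2003,
Def. 1 + Thm. 18, p. 359; Comput. Complexity 13 (2004), Thm. 1.1): if
`PIT ∈ ⋂_{ε>0} NTIME(2^{n^ε})` (realised as `∀ r > 0, PITLanguage ∈ NTIME(2^{⌊n^{1/r}⌋})`), then
`NEXP ⊄ P/poly` or the permanent family `(PER_n)` is not computable by p-bounded constant-free
arithmetic circuits over `ℤ`. Proof: the three-fact assembly `kabanets_impagliazzo_of_facts₃`
along Aaronson–van Melkebeek 2011, §3.3, applied to the discharges of Valiant's theorem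
(`permanent01_isSharpPHardFun_holds`), of Cor. 12 (`permanent01Graph_mem_NSUBEXP_of_PIT_holds`)
and of Lemma 3 (`PRel_per01_subset_NSUBEXP_of_graph_holds`).
[cite: KabanetsImpagliazzo2003, Def. 1 and Thm. 18 (p. 359)] [cite: KabanetsImpagliazzo2004, Thm. 1.1] [cite: AaronsonMelkebeek2011, Thm. 2.1 (proof, §3.3)] -/
theorem kabanets_impagliazzo_holds : kabanets_impagliazzo :=
  kabanets_impagliazzo_of_facts₃ permanent01_isSharpPHardFun_holds
    permanent01Graph_mem_NSUBEXP_of_PIT_holds PRel_per01_subset_NSUBEXP_of_graph_holds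

end Literature.Computability.AlgebraicComplexity

end
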